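import Mathlib
import Literature.AlgebraicGeometry.Resolution.RegularLocalRingsFlatDescent
import HarnessLib

/-!
# Invariants of a non-singular `p`-closed derivation are regular (Disproof §8 repaired — PROVED)

Crux workfile for `stmt-ResolutionOfSingularities-0549` (`Theses.Descent.DescentPerfectToAll`),
lineage res-B-lens-3 (g8).  `bears_on: LADDER-RESOLUTION:B · [OURS · CANDIDATE] counted 0;
nothing here proves resolution in char p`.

The standing disproof (`Cruxes/DescentPerfectToAll/Disproof.lean` §8) REFUTED
`InvariantsRegularOfNonsingularDerivation` (the kernel of a derivation `D` with `D x = 1` need not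
be regular: `D = ∂ₓ + x·E` is not `p`-closed; landed as
`Theorems/DescentPerfectToAll/Negative/InvariantsRegularOfNonsingularDerivationFalse.lean`) and
STATED, "not proved", the repaired target `InvariantsRegularOfPClosedNonsingularDerivation p`
(hypothesis `D^p = a·D` added; Disproof.lean l.565).  The sub-plan §11.2 (VISIBILITY PROPOSITION:
root-layer escape ⟺ a zero-free admissible `p`-closed derivation at a regular centre) rests on
exactly this statement.  THIS FILE PROVES IT (0 `sorry`):

* `InvariantsRegularOfPClosedNonsingularDerivation` — VERBATIM copy of the Disproof's `def`
  (this file cannot import the unbuilt `Disproof` module; the statement text is identical);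
* `invariantsRegularOfNilpotentDerivation` — the nilpotent normal form (`D^p = 0`, `D x = 1` ⟹
  `ker D` regular): Matsumura CRT Thm 27.3 (i) [Matsumura1987, p. 228] gives the Taylor basis
  `R = ⊕_{i<p} (ker D)·xⁱ` (`taylorBasis`), so `R` is free hence flat over `ker D`; `ker D` is
  local (`RingHom.domain_isLocalRing`) and Noetherian (ideals are contracted from `R` via the
  coordinate retraction); regularity DESCENDS along the flat local inclusion by the tree theorem
  `Literature.AlgebraicGeometry.Resolution.IsRegularLocalRing.of_flat_of_isLocalHom`
  (Matsumura Thm 23.7 (i));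
* `hochschildNormalisation` — a `p`-closed `D` with `D x` a unit rescales to `D₁ = (D x)⁻¹ D`
  with the same kernel, `D₁ x = 1` AND `D₁^p = 0`.  Proved WITHOUT Hochschild's formula
  `(gD)^p = g^p D^p + (gD)^{p-1}(g)·D` [Matsumura1987, §25]: positive powers of `g • E` are
  `R`-combinations of `E¹,…,Eⁿ` (`InSpan.iterate_smul`), `p`-closedness folds the top power back,
  and an `E`-combination of length `< p` killing `x,…,x^{p-1}` vanishes (triangular elimination,
  `E^{m+1} x^{m+1} = (m+1)!` a unit in characteristic `p`);
* `invariantsRegularOfPClosedNonsingularDerivation : InvariantsRegularOfPClosedNonsingularDerivation p`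
  — the repaired §8 target, kernel-checked from the two.

Honours the landed negative `…Negative.not_invariantsRegularOfNonsingularDerivation`:
`p`-closedness is used exactly once, to fold `D^p` in `hochschildNormalisation` (without it the
witness `∂ₓ + x·E` has `D₁ = D`, `D^p ≠ 0`, and the Taylor expansion does not terminate).
-/

noncomputable section

set_option linter.unusedVariables false
set_option linter.unusedSectionVars false
set_option linter.dupNamespace false
set_option linter.unusedSimpArgs false

open IsLocalRing

namespace Summit.ResolutionOfSingularities.ResolutionOfSingularities.Cruxes.DescentPerfectToAll.PClosedInvariants

/-! ## The statements -/

/-- VERBATIM copy of `…Cruxes.DescentPerfectToAll.Disproof.InvariantsRegularOfPClosedNonsingularDerivation`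
(Disproof.lean l.565, "repaired §8 target — stated, not proved"). -/
def InvariantsRegularOfPClosedNonsingularDerivation (p : ℕ) [Fact p.Prime] : Prop :=
  ∀ (R : Type) [CommRing R] [IsRegularLocalRing R] [CharP R p] (D : Derivation ℤ R R)
    (S : Subring R), (∀ x : R, x ∈ S ↔ D x = 0) → Module.Finite S R →
    (∃ a : R, ∀ x : R, (⇑D)^[p] x = a * D x) →
    (∃ x : R, IsUnit (D x)) → IsRegularLocalRing S

/-- Nilpotent normal form: `D^p = 0`, `D x = 1` ⟹ the ring of invariants is regular
(no finiteness hypothesis needed: freeness of rank `p` is a CONSEQUENCE, CRT 27.3 (i)). -/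
def InvariantsRegularOfNilpotentDerivation (p : ℕ) [Fact p.Prime] : Prop :=
  ∀ (R : Type) [CommRing R] [IsRegularLocalRing R] [CharP R p] (D : Derivation ℤ R R)
    (S : Subring R), (∀ x : R, x ∈ S ↔ D x = 0) →
    (∀ x : R, (⇑D)^[p] x = 0) → (∃ x : R, D x = 1) → IsRegularLocalRing S

/-- Hochschild normalisation (classical; the stub of this file): a `p`-closed derivation with
`D x` a unit rescales to a derivation with the same kernel, `D₁ x = 1` and `D₁^p = 0`
(`D₁ := (D x)⁻¹ D`; Hochschild's formula gives `D₁^p = c D₁`, and `c = D₁^p x = D₁^{p-1} 1 = 0`). -/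
def HochschildNormalisation (p : ℕ) [Fact p.Prime] : Prop :=
  ∀ (R : Type) [CommRing R] [CharP R p] (D : Derivation ℤ R R),
    (∃ a : R, ∀ x : R, (⇑D)^[p] x = a * D x) → ∀ x : R, IsUnit (D x) →
      ∃ D₁ : Derivation ℤ R R,
        (∀ y : R, D₁ y = 0 ↔ D y = 0) ∧ (∀ y : R, (⇑D₁)^[p] y = 0) ∧ D₁ x = 1

/-! ## Taylor expansion along a derivation (Matsumura, CRT Thm 27.3 (i)) -/

section Taylor

variable {R : Type*} [CommRing R] (D : Derivation ℤ R R)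

theorem iterate_map_zero (n : ℕ) : (⇑D)^[n] 0 = 0 := by
  induction n with
  | zero => rfl
  | succ n ih => rw [Function.iterate_succ_apply, map_zero, ih]

theorem iterate_map_add (n : ℕ) : ∀ a b : R, (⇑D)^[n] (a + b) = (⇑D)^[n] a + (⇑D)^[n] b := by
  induction n with
  | zero => intro a b; rfl
  | succ n ih => intro a b; rw [Function.iterate_succ_apply, map_add, ih]; rfl

theorem iterate_map_neg (n : ℕ) : ∀ a : R, (⇑D)^[n] (-a) = -(⇑D)^[n] a := by
  induction n with
  | zero => intro a; rfl
  | succ n ih => intro a; rw [Function.iterate_succ_apply, map_neg, ih]; rfl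

theorem iterate_map_sub (n : ℕ) (a b : R) : (⇑D)^[n] (a - b) = (⇑D)^[n] a - (⇑D)^[n] b := by
  rw [sub_eq_add_neg, iterate_map_add, iterate_map_neg, ← sub_eq_add_neg]

/-- constants pass through every iterate: `D c = 0 ⟹ Dⁿ(c·y) = c·Dⁿ y`. -/
theorem iterate_map_const_mul (n : ℕ) {c : R} (hc : D c = 0) :
    ∀ y : R, (⇑D)^[n] (c * y) = c * (⇑D)^[n] y := by
  induction n with
  | zero => intro y; rfl
  | succ n ih =>
      intro y
      rw [Function.iterate_succ_apply, Function.iterate_succ_apply, D.leibniz, hc, smul_zero,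
        add_zero, smul_eq_mul, ih]

theorem iterate_map_sum (n : ℕ) {ι : Type*} (s : Finset ι) (f : ι → R) :
    (⇑D)^[n] (∑ i ∈ s, f i) = ∑ i ∈ s, (⇑D)^[n] (f i) := by
  classical
  induction s using Finset.induction_on with
  | empty => simp [iterate_map_zero]
  | insert a s ha ih => rw [Finset.sum_insert ha, Finset.sum_insert ha, iterate_map_add, ih]

variable {D}

/-- `D x = 1 ⟹ D (x^(j+1)) = (j+1)·x^j`. -/
theorem map_pow_succ_of {x : R} (hx : D x = 1) (j : ℕ) :
    D (x ^ (j + 1)) = ((j + 1 : ℕ) : R) * x ^ j := by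
  rw [D.leibniz_pow, hx, Nat.add_sub_cancel, smul_eq_mul, mul_one, nsmul_eq_mul]

/-- `D x = 1 ⟹ Dⁱ(xʲ) = 0` for `j < i`. -/
theorem iterate_pow_of_lt {x : R} (hx : D x = 1) :
    ∀ i j : ℕ, j < i → (⇑D)^[i] (x ^ j) = 0 := by
  intro i
  induction i with
  | zero => intro j hj; exact absurd hj (Nat.not_lt_zero j)
  | succ i ih =>
      intro j hj
      rw [Function.iterate_succ_apply]
      cases j with
      | zero => rw [pow_zero, D.map_one_eq_zero, iterate_map_zero]
      | succ j =>
          rw [map_pow_succ_of hx, iterate_map_const_mul D i (D.map_natCast _), ih j (by omega),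
            mul_zero]

/-- `D x = 1 ⟹ Dⁱ(xⁱ) = i!`. -/
theorem iterate_pow_self {x : R} (hx : D x = 1) :
    ∀ i : ℕ, (⇑D)^[i] (x ^ i) = ((i.factorial : ℕ) : R) := by
  intro i
  induction i with
  | zero => simp
  | succ i ih =>
      rw [Function.iterate_succ_apply, map_pow_succ_of hx, iterate_map_const_mul D i
        (D.map_natCast _), ih, Nat.factorial_succ, Nat.cast_mul]

/-- In characteristic `p`, `i! ` is a unit for `i < p`. -/
theorem isUnit_factorial_cast (p : ℕ) [Fact p.Prime] [CharP R p] {i : ℕ} (hi : i < p) :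
    IsUnit ((i.factorial : ℕ) : R) := by
  have hcop : Nat.Coprime i.factorial p :=
    (Nat.Coprime.symm ((Nat.Prime.coprime_iff_not_dvd (Fact.out)).2
      (by
        intro h
        exact absurd ((Nat.Prime.dvd_factorial (Fact.out)).1 h) (by omega))))
  -- `i!` is a unit in `ZMod p`, hence in `R` via the characteristic map
  have hu : IsUnit ((i.factorial : ℕ) : ZMod p) := by
    rw [ZMod.isUnit_iff_coprime]
    exact hcop
  have := hu.map (ZMod.castHom (dvd_refl p) R)
  simpa using this

/-- the inverse of a unit constant is a constant -/
theorem map_inv_eq_zero_of {c : R} (hc : D c = 0) (u : Rˣ) (hu : (u : R) = c) :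
    D (↑u⁻¹ : R) = 0 := by
  have h1 : D ((u : R) * (↑u⁻¹ : R)) = 0 := by rw [Units.mul_inv, D.map_one_eq_zero]
  rw [D.leibniz, smul_eq_mul, smul_eq_mul, hu, hc, mul_zero, add_zero] at h1
  -- h1 : c * D ↑u⁻¹ = 0
  have h2 := congrArg (fun z => (↑u⁻¹ : R) * z) h1
  simp only [mul_zero] at h2
  rwa [← mul_assoc, ← hu, Units.inv_mul, one_mul] at h2

variable (p : ℕ) [Fact p.Prime] [CharP R p]

/-- **CRT 27.3 (i), generation** (Matsumura's induction): if `D x = 1` then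
`D^{i+1} a = 0 ⟹ a ∈ Σ_{j ≤ i} (ker D)·xʲ`, for `i < p`. -/
theorem mem_span_of_iterate_succ_eq_zero (S : Subring R) (hS : ∀ y : R, y ∈ S ↔ D y = 0)
    {x : R} (hx : D x = 1) :
    ∀ i : ℕ, i < p → ∀ a : R, (⇑D)^[i + 1] a = 0 →
      a ∈ Submodule.span S (Set.range fun j : Fin p => x ^ (j : ℕ)) := by
  intro i
  induction i with
  | zero =>
      intro hp a ha
      -- `D a = 0`: `a ∈ S`, and `a = a • x^0`
      have haS : a ∈ S := (hS a).2 (by simpa using ha)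
      have : a = (⟨a, haS⟩ : S) • ((fun j : Fin p => x ^ (j : ℕ)) ⟨0, hp⟩) := by
        simp [Algebra.smul_def, Algebra.algebraMap_ofSubsemiring_apply]
      rw [this]
      exact Submodule.smul_mem _ _ (Submodule.subset_span ⟨⟨0, hp⟩, rfl⟩)
  | succ i ih =>
      intro hip a ha
      -- c := (i+1)!⁻¹ · D^{i+1} a is a constant
      obtain ⟨u, hu⟩ := isUnit_factorial_cast (R := R) p (i := i + 1) hip
      set c : R := (↑u⁻¹ : R) * (⇑D)^[i + 1] a with hc_def
      have hDa : D ((⇑D)^[i + 1] a) = 0 := by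
        have := ha
        rw [Function.iterate_succ_apply'] at this
        exact this
      have hcu : D (↑u⁻¹ : R) = 0 := map_inv_eq_zero_of (D.map_natCast _) u hu
      have hc : D c = 0 := by
        rw [hc_def, D.leibniz, hDa, hcu, smul_zero, smul_zero, add_zero]
      -- b := a - c x^{i+1} has D^{i+1} b = 0
      have hb : (⇑D)^[i + 1] (a - c * x ^ (i + 1)) = 0 := by
        rw [iterate_map_sub, iterate_map_const_mul D (i + 1) hc, iterate_pow_self hx (i + 1),
          hc_def, mul_assoc, ← hu, mul_comm ((⇑D)^[i + 1] a) (u : R), Units.inv_mul_cancel_left,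
          sub_self]
      have hbmem := ih (by omega) (a - c * x ^ (i + 1)) hb
      have hcx : c * x ^ (i + 1) ∈ Submodule.span S (Set.range fun j : Fin p => x ^ (j : ℕ)) := by
        have hcS : c ∈ S := (hS c).2 hc
        have : c * x ^ (i + 1) = (⟨c, hcS⟩ : S) • ((fun j : Fin p => x ^ (j : ℕ)) ⟨i + 1, hip⟩) := by
          simp [Algebra.smul_def, Algebra.algebraMap_ofSubsemiring_apply]
        rw [this]
        exact Submodule.smul_mem _ _ (Submodule.subset_span ⟨⟨i + 1, hip⟩, rfl⟩)
      have : a = (a - c * x ^ (i + 1)) + c * x ^ (i + 1) := by ring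
      rw [this]
      exact Submodule.add_mem _ hbmem hcx

/-- **CRT 27.3 (i), spanning**: `D^p = 0`, `D x = 1` ⟹ `1, x, …, x^{p-1}` span `R` over `ker D`. -/
theorem span_pow_eq_top (S : Subring R) (hS : ∀ y : R, y ∈ S ↔ D y = 0)
    (hDp : ∀ y : R, (⇑D)^[p] y = 0) {x : R} (hx : D x = 1) :
    Submodule.span S (Set.range fun j : Fin p => x ^ (j : ℕ)) = ⊤ := by
  rw [Submodule.eq_top_iff']
  intro a
  have hp1 : p - 1 + 1 = p := Nat.sub_add_cancel (Fact.out : p.Prime).one_lt.le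
  exact mem_span_of_iterate_succ_eq_zero p S hS hx (p - 1) (by omega) a (by rw [hp1]; exact hDp a)

/-- **CRT 27.3 (i), independence**: `D x = 1` ⟹ `1, x, …, x^{p-1}` are linearly independent
over `ker D` (apply `Dⁿ` to a relation and read off the top coefficient: `n!·g n = 0`). -/
theorem linearIndependent_pow (S : Subring R) (hS : ∀ y : R, y ∈ S ↔ D y = 0)
    {x : R} (hx : D x = 1) :
    LinearIndependent S (fun j : Fin p => x ^ (j : ℕ)) := by
  rw [Fintype.linearIndependent_iff]
  intro g hg
  -- downward induction, phrased upward in `k`: all coefficients of index `≥ p - k` vanish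
  suffices H : ∀ k : ℕ, ∀ j : Fin p, p ≤ (j : ℕ) + k → g j = 0 from
    fun j => H p j (by omega)
  intro k
  induction k with
  | zero => intro j hj; exact absurd j.2 (by omega)
  | succ k ih =>
      intro j hj
      by_cases hj' : p ≤ (j : ℕ) + k
      · exact ih j hj'
      -- here `(j : ℕ) + k + 1 = p`: apply `D^j` to the relation
      have hrel := congrArg (fun z => (⇑D)^[(j : ℕ)] z) hg
      simp only [iterate_map_zero, iterate_map_sum] at hrel
      have hterm : ∀ i ∈ (Finset.univ : Finset (Fin p)),
          (⇑D)^[(j : ℕ)] (g i • x ^ (i : ℕ)) =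
            if i = j then (g j : R) * (((j : ℕ).factorial : ℕ) : R) else 0 := by
        intro i _
        have hgS : D (g i : R) = 0 := (hS _).1 (g i).2
        rw [Algebra.smul_def, Algebra.algebraMap_ofSubsemiring_apply,
          iterate_map_const_mul D (j : ℕ) hgS]
        by_cases hij : i = j
        · subst hij; rw [if_pos rfl, iterate_pow_self hx]
        · rw [if_neg hij]
          rcases lt_or_gt_of_ne (fun h : (i : ℕ) = j => hij (Fin.ext h)) with hl | hg'
          · rw [iterate_pow_of_lt hx (j : ℕ) i hl, mul_zero]
          · rw [ih i (by omega)]; simp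
      rw [Finset.sum_congr rfl hterm, Finset.sum_ite_eq' Finset.univ j,
        if_pos (Finset.mem_univ j)] at hrel
      obtain ⟨u, hu⟩ := isUnit_factorial_cast (R := R) p (i := (j : ℕ)) j.2
      have h0 : (g j : R) = 0 := by
        have := congrArg (fun z => z * (↑u⁻¹ : R)) hrel
        simp only [zero_mul] at this
        rwa [← hu, Units.mul_inv_cancel_right] at this
      exact Subtype.ext h0

/-- **CRT 27.3 (i)**: the Taylor basis `1, x, …, x^{p-1}` of `R` over `ker D`. -/
def taylorBasis (S : Subring R) (hS : ∀ y : R, y ∈ S ↔ D y = 0)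
    (hDp : ∀ y : R, (⇑D)^[p] y = 0) {x : R} (hx : D x = 1) : Module.Basis (Fin p) S R :=
  Module.Basis.mk (linearIndependent_pow p S hS hx) (span_pow_eq_top p S hS hDp hx).ge

end Taylor

/-! ## Normalisation without Hochschild's formula

We avoid Hochschild's explicit formula `(gE)^p = g^p E^p + (gE)^{p-1}(g)·E`: it suffices that
positive powers of `g • E` are `R`-combinations of `E, E², …` (trivial induction), that
`p`-closedness folds `D^p` back to `D`, and that a combination `Σ_{m<p-1} t_m E^{m+1}` which
kills `x, x², …, x^{p-1}` (where `E x = 1`) has all `t_m = 0` (triangular elimination,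
`E^{m+1} x^{m+1} = (m+1)!` a unit). -/

section Normalise

variable {R : Type*} [CommRing R]

/-- `T` is an `R`-combination of `E¹, …, Eᴺ`. -/
def InSpan (E : Derivation ℤ R R) (N : ℕ) (T : R → R) : Prop :=
  ∃ t : ℕ → R, ∀ y : R, T y = ∑ m ∈ Finset.range N, t m * (⇑E)^[m + 1] y

namespace InSpan

variable {E : Derivation ℤ R R} {N : ℕ} {T T₁ T₂ : R → R}

theorem congr (h : ∀ y, T₁ y = T₂ y) (h₁ : InSpan E N T₁) : InSpan E N T₂ := by
  obtain ⟨t, ht⟩ := h₁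
  exact ⟨t, fun y => (h y).symm.trans (ht y)⟩

theorem zero : InSpan E N (fun _ => 0) :=
  ⟨fun _ => 0, fun y => by simp⟩

theorem add (h₁ : InSpan E N T₁) (h₂ : InSpan E N T₂) : InSpan E N (fun y => T₁ y + T₂ y) := by
  obtain ⟨t₁, h₁⟩ := h₁
  obtain ⟨t₂, h₂⟩ := h₂
  refine ⟨fun m => t₁ m + t₂ m, fun y => ?_⟩
  show T₁ y + T₂ y = _
  rw [h₁ y, h₂ y, ← Finset.sum_add_distrib]
  exact Finset.sum_congr rfl fun m _ => by ring

theorem mul_left (g : R) (h : InSpan E N T) : InSpan E N (fun y => g * T y) := by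
  obtain ⟨t, ht⟩ := h
  refine ⟨fun m => g * t m, fun y => ?_⟩
  show g * T y = _
  rw [ht y, Finset.mul_sum]
  exact Finset.sum_congr rfl fun m _ => by ring

theorem single {m : ℕ} (hm : m < N) : InSpan E N ((⇑E)^[m + 1]) := by
  classical
  refine ⟨fun k => if k = m then 1 else 0, fun y => ?_⟩
  simp [Finset.sum_ite_eq', Finset.mem_range, hm]

theorem mono {N' : ℕ} (hN : N ≤ N') (h : InSpan E N T) : InSpan E N' T := by
  classical
  obtain ⟨t, ht⟩ := h
  refine ⟨fun m => if m < N then t m else 0, fun y => ?_⟩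
  rw [ht y]
  have h1 : ∀ m ∈ Finset.range N,
      t m * (⇑E)^[m + 1] y = (if m < N then t m else 0) * (⇑E)^[m + 1] y := by
    intro m hm
    rw [if_pos (Finset.mem_range.1 hm)]
  rw [Finset.sum_congr rfl h1]
  apply Finset.sum_subset (Finset.range_mono hN)
  intro m _ hm'
  rw [if_neg (fun h => hm' (Finset.mem_range.2 h)), zero_mul]

/-- composing with `E` raises the length by one (Leibniz). -/
theorem comp (h : InSpan E N T) : InSpan E (N + 1) (fun y => E (T y)) := by
  obtain ⟨t, ht⟩ := h
  have h1 : InSpan E (N + 1) (fun y => ∑ m ∈ Finset.range N, E (t m) * (⇑E)^[m + 1] y) :=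
    mono (Nat.le_succ N) ⟨fun m => E (t m), fun y => rfl⟩
  have h2 : InSpan E (N + 1) (fun y => ∑ m ∈ Finset.range N, t m * (⇑E)^[m + 2] y) := by
    refine ⟨fun m => match m with | 0 => 0 | m + 1 => t m, fun y => ?_⟩
    rw [Finset.sum_range_succ']
    simp
  refine congr (fun y => ?_) (add h2 h1)
  rw [ht y, map_sum, ← Finset.sum_add_distrib]
  refine Finset.sum_congr rfl fun m _ => ?_
  rw [E.leibniz, smul_eq_mul, smul_eq_mul, ← Function.iterate_succ_apply' (⇑E) (m + 1) y]
  ring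

/-- positive powers of `g • E` are combinations of `E¹, …, Eⁿ⁺¹`. -/
theorem iterate_smul (E : Derivation ℤ R R) (g : R) :
    ∀ n : ℕ, InSpan E (n + 1) (⇑(g • E))^[n + 1] := by
  intro n
  induction n with
  | zero =>
      refine ⟨fun _ => g, fun y => ?_⟩
      simp [Derivation.smul_apply]
  | succ n ih =>
      refine congr (fun y => ?_) ((comp ih).mul_left g)
      rw [Function.iterate_succ_apply' (⇑(g • E)) (n + 1) y, Derivation.smul_apply, smul_eq_mul]

/-- combinations of combinations -/
theorem sum {s : Finset ℕ} {V : ℕ → R → R} (t : ℕ → R) (hV : ∀ k ∈ s, InSpan E N (V k)) :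
    InSpan E N (fun y => ∑ k ∈ s, t k * V k y) := by
  classical
  induction s using Finset.induction_on with
  | empty => exact congr (fun y => by simp) zero
  | insert a s ha ih =>
      have h := add ((hV a (Finset.mem_insert_self a s)).mul_left (t a))
        (ih fun k hk => hV k (Finset.mem_insert_of_mem hk))
      exact congr (fun y => by rw [Finset.sum_insert ha]) h

/-- change of base derivation: if `D = u·E` then `D`-combinations are `E`-combinations. -/
theorem of_mul {D : Derivation ℤ R R} {u : R} (hDE : ∀ y, D y = u * E y) (h : InSpan D N T) :
    InSpan E N T := by
  obtain ⟨t, ht⟩ := h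
  have hDeq : (⇑D) = ⇑(u • E) := funext fun y => by rw [Derivation.smul_apply, smul_eq_mul, hDE]
  have hV : ∀ k ∈ Finset.range N, InSpan E N ((⇑D)^[k + 1]) := by
    intro k hk
    rw [hDeq]
    exact mono (Nat.succ_le_of_lt (Finset.mem_range.1 hk)) (iterate_smul E u k)
  exact congr (fun y => (ht y).symm) (sum t hV)

end InSpan

/-- **PROVED** (Hochschild-free): a `p`-closed derivation with a unit value rescales to a
nilpotent one with the same kernel and `D₁ x = 1`. -/
theorem hochschildNormalisation (p : ℕ) [Fact p.Prime] : HochschildNormalisation p := by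
  intro R _ _ D ha x hux
  obtain ⟨a, ha⟩ := ha
  obtain ⟨u, hu⟩ := hux
  obtain ⟨q, rfl⟩ : ∃ q, p = q + 1 := ⟨p - 1, (Nat.sub_add_cancel (Fact.out : p.Prime).pos).symm⟩
  have hq : 1 ≤ q := by
    have := (Fact.out : (q + 1).Prime).two_le
    omega
  set E : Derivation ℤ R R := (↑u⁻¹ : R) • D with hE_def
  have hE : ∀ y, E y = ↑u⁻¹ * D y := fun y => by rw [hE_def, Derivation.smul_apply, smul_eq_mul]
  have hDE : ∀ y, D y = ↑u * E y := fun y => by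
    rw [hE, ← mul_assoc, Units.mul_inv, one_mul]
  have hEx : E x = 1 := by rw [hE, ← hu, Units.inv_mul]
  refine ⟨E, fun y => ⟨fun h => by rw [hDE, h, mul_zero], fun h => by rw [hE, h, mul_zero]⟩,
    ?_, hEx⟩
  -- (i) `E^p` is a `D`-combination of length `p` …
  obtain ⟨c, hc⟩ : InSpan D (q + 1) (⇑E)^[q + 1] := InSpan.iterate_smul D (↑u⁻¹ : R) q
  -- (ii) … of length `p - 1` by `p`-closedness …
  have hsplit : ∀ y, (⇑E)^[q + 1] y =
      (∑ k ∈ Finset.range q, c k * (⇑D)^[k + 1] y) + (c q * a) * (⇑D)^[0 + 1] y := by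
    intro y
    rw [hc y, Finset.sum_range_succ, ha]
    simp [mul_assoc]
  have h2 : InSpan D q (⇑E)^[q + 1] :=
    InSpan.congr (fun y => (hsplit y).symm)
      (InSpan.add ⟨c, fun y => rfl⟩ ((InSpan.single (by omega : 0 < q)).mul_left (c q * a)))
  -- (iii) … hence an `E`-combination of length `p - 1`
  obtain ⟨t, ht⟩ : InSpan E q (⇑E)^[q + 1] := InSpan.of_mul hDE h2
  -- (iv) triangular elimination against `x, x², …, x^{p-1}`
  have hzero : ∀ m, m < q → t m = 0 := by
    intro m
    refine Nat.strong_induction_on m ?_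
    intro m ih hm
    have hev := ht (x ^ (m + 1))
    rw [iterate_pow_of_lt hEx (q + 1) (m + 1) (by omega), Finset.sum_eq_single m,
      iterate_pow_self hEx (m + 1)] at hev
    · obtain ⟨w, hw⟩ := isUnit_factorial_cast (R := R) (q + 1) (i := m + 1) (by omega)
      have h0 := congrArg (fun z => z * (↑w⁻¹ : R)) hev
      simp only [zero_mul] at h0
      rw [← hw, Units.mul_inv_cancel_right] at h0
      exact h0.symm
    · intro m' hm' hne
      rcases lt_or_gt_of_ne hne with hl | hg
      · rw [ih m' hl (by omega), zero_mul]
      · rw [iterate_pow_of_lt hEx (m' + 1) (m + 1) (by omega), mul_zero]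
    · intro hnot
      exact absurd (Finset.mem_range.2 hm) hnot
  intro y
  rw [ht y]
  exact Finset.sum_eq_zero fun m hm => by rw [hzero m (Finset.mem_range.1 hm), zero_mul]

end Normalise

/-! ## Descent: the ring of invariants is local, Noetherian, and `R` is flat over it -/

section Descent

variable {R : Type*} [CommRing R] (D : Derivation ℤ R R) (S : Subring R)
  (hS : ∀ y : R, y ∈ S ↔ D y = 0)
include hS

/-- a constant which is a unit of `R` is a unit of `ker D` -/
theorem isLocalHom_algebraMap : IsLocalHom (algebraMap S R) := by
  constructor
  intro s hs
  obtain ⟨u, hu⟩ := hs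
  have hinv : D (↑u⁻¹ : R) = 0 := map_inv_eq_zero_of ((hS _).1 s.2) u hu
  refine ⟨⟨s, ⟨(↑u⁻¹ : R), (hS _).2 hinv⟩, ?_, ?_⟩, rfl⟩
  · apply Subtype.ext
    change (s : R) * (↑u⁻¹ : R) = 1
    rw [← show (u : R) = (s : R) from hu, Units.mul_inv]
  · apply Subtype.ext
    change (↑u⁻¹ : R) * (s : R) = 1
    rw [← show (u : R) = (s : R) from hu, Units.inv_mul]

theorem isLocalRing [IsLocalRing R] : IsLocalRing S :=
  haveI := isLocalHom_algebraMap D S hS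
  RingHom.domain_isLocalRing (algebraMap S R)

omit hS in
/-- A subring over which the ambient Noetherian ring has a basis containing `1` is Noetherian
(ideals are contracted from their extensions: `I·R ∩ S = I`). -/
theorem isNoetherianRing_of_basis [IsNoetherianRing R] {ι : Type*} (b : Module.Basis ι S R) (i₀ : ι)
    (hb : b i₀ = 1) : IsNoetherianRing S := by
  -- the coordinate `i₀` is an `S`-linear retraction of the inclusion
  let π : R →ₗ[S] S := b.coord i₀
  have hπ : ∀ s : S, π (s : R) = s := by
    intro s
    have : (s : R) = s • b i₀ := by rw [hb, Algebra.smul_def, mul_one]; rfl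
    change b.coord i₀ (s : R) = s
    rw [this, map_smul, Module.Basis.coord_apply, Module.Basis.repr_self, Finsupp.single_eq_same,
      smul_eq_mul, mul_one]
  -- contraction: comap (map I) = I
  have hcontr : ∀ I : Ideal S, (I.map (algebraMap S R)).comap (algebraMap S R) = I := by
    intro I
    apply le_antisymm _ Ideal.le_comap_map
    intro s hs
    rw [Ideal.mem_comap] at hs
    -- `(s : R) ∈ I·R = I • ⊤`; apply `π`
    have hmem : (algebraMap S R s) ∈ I • (⊤ : Submodule S R) := by
      rw [Ideal.smul_top_eq_map]; exact hs
    have hπmem : π (algebraMap S R s) ∈ I := by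
      refine Submodule.smul_induction_on hmem ?_ ?_
      · intro r hr m _
        rw [map_smul, smul_eq_mul]
        exact Ideal.mul_mem_right _ _ hr
      · intro a c ha hc
        rw [map_add]; exact I.add_mem ha hc
    rwa [Algebra.algebraMap_ofSubsemiring_apply, hπ] at hπmem
  -- ACC transfers along the injective monotone map `I ↦ I·R`
  rw [isNoetherianRing_iff, isNoetherian_iff']
  have hmono : StrictMono (fun I : Ideal S => I.map (algebraMap S R)) := by
    refine Monotone.strictMono_of_injective (fun I J h => Ideal.map_mono h) ?_
    intro I J h
    have := congrArg (fun K : Ideal R => K.comap (algebraMap S R)) h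
    simpa only [hcontr] using this
  haveI : WellFoundedGT (Ideal R) := isNoetherian_iff'.1 (isNoetherianRing_iff.1 ‹_›)
  exact hmono.wellFoundedGT

end Descent

/-! ## The theorems -/

/-- **PROVED**: the nilpotent normal form (CRT 27.3 (i) + flat descent of regularity). -/
theorem invariantsRegularOfNilpotentDerivation (p : ℕ) [Fact p.Prime] :
    InvariantsRegularOfNilpotentDerivation p := by
  intro R _ _ _ D S hS hDp hx
  obtain ⟨x, hx⟩ := hx
  let b : Module.Basis (Fin p) S R := taylorBasis p S hS hDp hx
  have hb0 : b ⟨0, (Fact.out : p.Prime).pos⟩ = 1 := by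
    change (Module.Basis.mk _ _) _ = 1
    rw [Module.Basis.mk_apply]; simp
  haveI : IsNoetherianRing S := isNoetherianRing_of_basis S b ⟨0, (Fact.out : p.Prime).pos⟩ hb0
  haveI : IsLocalRing S := isLocalRing D S hS
  haveI : IsLocalHom (algebraMap S R) := isLocalHom_algebraMap D S hS
  haveI : Module.Free S R := Module.Free.of_basis b
  haveI : Module.Flat S R := inferInstance
  exact Literature.AlgebraicGeometry.Resolution.IsRegularLocalRing.of_flat_of_isLocalHom S R

/-- kernel: repaired §8 statement from the normalisation and the nilpotent form. -/
theorem invariantsRegularOfPClosedNonsingularDerivation_of {p : ℕ} [Fact p.Prime]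
    (hH : HochschildNormalisation p) (hN : InvariantsRegularOfNilpotentDerivation p) :
    InvariantsRegularOfPClosedNonsingularDerivation p := by
  intro R _ _ _ D S hS _ hpc hx
  obtain ⟨x, hux⟩ := hx
  obtain ⟨D₁, hker, hnil, h1⟩ := hH R D hpc x hux
  exact hN R D₁ S (fun y => (hS y).trans (hker y).symm) hnil ⟨x, h1⟩

/-- **Disproof §8 repaired target — PROVED.** -/
theorem invariantsRegularOfPClosedNonsingularDerivation (p : ℕ) [Fact p.Prime] :
    InvariantsRegularOfPClosedNonsingularDerivation p :=
  invariantsRegularOfPClosedNonsingularDerivation_of (hochschildNormalisation p)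
    (invariantsRegularOfNilpotentDerivation p)

end Summit.ResolutionOfSingularities.ResolutionOfSingularities.Cruxes.DescentPerfectToAll.PClosedInvariants

end
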